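import Literature.NumberTheory.LFunctions.MoebiusAutomaticPowReduction
import Literature.NumberTheory.LFunctions.MoebiusAutomaticExpSumBridge
import HarnessLib

/-!
# Müllner's theorem from the AP-form of Prop. 3.2 for automata with `d = k₀ = 1` (proved glue)

Everything in this file is PROVED. It composes the sharpened reduction
`mullner_moebius_automatic_of_transducerEstimate_dk1` (`MoebiusAutomaticPowReduction.lean`:
Prop. 3.3 after the base change of Prop. 2.25) with the bridge
`transducerMoebiusEstimate_of_apEstimate` (`MoebiusAutomaticExpSumBridge.lean`: Prop. 3.2 in
arithmetic-progression form ⇒ the transducer estimate): the named fact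
`mullner_moebius_automatic` (C. Müllner, Duke Math. J. 166 (2017), Thm. 1.2 for `ξ = a`) follows
once `TransducerAPEstimate K δ' M₀` holds for every state `M₀` of the naturally induced transducer
of every strongly connected base-`K` automaton `δ'` (`K ≥ 2`, letters `≥ K` trivial) with

  `transducerPeriod K δ' = 1` and `transducerK0 hK δ' htriv' = 1`,

i.e. exactly for the automata produced by Prop. 2.25, for which §4 of the paper (Thm. 4.4 with
the carry property Lemma 4.10 and the Fourier property Thm. 4.5) is written.

## References
* C. Müllner, Duke Math. J. 166 (2017) = arXiv:1602.03042: Prop. 2.25, Prop. 3.2, Prop. 3.3,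
  §4.3. [Mullner2017]
-/

noncomputable section

namespace Literature.NumberTheory.LFunctions

/-- **Müllner's Thm. 1.2 (`ξ = a`) from the AP-form of Prop. 3.2 for automata with `d = k₀ = 1`.**
[cite: Mullner2017, Prop. 3.3 / Prop. 2.25 / §4.3] -/
theorem mullner_moebius_automatic_of_apEstimate_dk1
    (H : ∀ (K : ℕ) (hK : 2 ≤ K) (σ' : Type) [Fintype σ'] [DecidableEq σ'] (δ' : σ' → ℕ → σ'),
      IsStronglyConnected δ' → ∀ (htriv' : ∀ q d, K ≤ d → δ' q d = q),
      transducerPeriod K δ' = 1 → transducerK0 hK δ' htriv' = 1 →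
      ∀ M₀ : MinImage δ', TransducerAPEstimate K δ' M₀) :
    mullner_moebius_automatic :=
  mullner_moebius_automatic_of_transducerEstimate_dk1
    fun K hK σ' _ _ δ' hsc htriv' hd hk0 M π l1 l2 =>
      (transducerMoebiusEstimate_of_apEstimate hK htriv' (H K hK σ' δ' hsc htriv' hd hk0) M π l1 l2).sync

end Literature.NumberTheory.LFunctions
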